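import Summits.MatrixMultiplication.MatrixMultiplication.Theorems.ObstructionDescentEmptyLevelFormat
import Summits.MatrixMultiplication.MatrixMultiplication.Theorems.ObstructionDescentUnitParity
import Summits.MatrixMultiplication.MatrixMultiplication.Theorems.ObstructionDescentLevelOne

set_option linter.dupNamespace false

/-!
# The invariant tower is ONE CELL per `(τ, n)`; above the cubic scale hypothesis (K0) is vacuous (decomp-mm · lens 3 · gen 17)

Route `route-MatrixMultiplication-ObstructionDescent` (sub-problem `MatrixMultiplication`, `ω(ℂ) = 2`), rev 7 `3f9f51b758cc`;
support for the aside **`InvariantSaturation`** (item `stmt-MatrixMultiplication-32282`, the invariant tower, read in levels by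
`invariantSaturation_iff_levels`: for `2 < τ < 4`, eventually in `n`, at every cell `n² ≤ m`, `n^τ ≤ m`, every level `k` of
degree `k·n² > m` passes or is empty).  Imports only LANDED files (`ObstructionDescentEmptyLevelFormat` ⊇ `LevelMonoid`,
`WitnessPoints`, `InvariantTower`; `ObstructionDescentUnitParity`; `ObstructionDescentLevelOne`); restates nothing.

This file is the UPPER-BOUND-SIDE bookkeeping the critic asked for (the laws of parts K–AF bound `r_N(k)` from below; the
item needs pass-or-empty from above):

* **§1 Monotonicity of the dichotomy in the secant order.**  `passLevels m N ⊆ passLevels m' N` (landed H11a) and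
  `emptyLevels m' N = emptyLevels m N` (landed format independence) give `tower_mono`: the tower at a cell `(n, m)` implies
  the tower at every cell `(n, m')`, `m ≤ m'` — fewer levels are asked for and each keeps its status.
* **§2 Hence the item is ONE CELL PER `(τ, n)`** (`invariantSaturation_iff_lowestCell`): `InvariantSaturation` holds iff for
  every `2 < τ < 4`, eventually in `n`, the tower holds at SOME cell `m₀ ≥ n²` lying below every admissible cell (e.g. the lowest
  one, `m₀ = max (n², ⌈n^τ⌉)`).  The landed `invariantSaturation_of_firstCellRuns` is the special case «a passing run at `m₀`».
* **§3 The first cell.**  At `m = N` passing levels are exactly the levels of the POINT `⟨m⟩`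
  (`passLevels_self_eq_pointLevels`, by the landed `GL_m³`-invariance of level sets), so the tower at the first cell `(n, n²)` says
  «every non-empty level `≥ 2` is a level of `⟨n²⟩`» (`tower_self_iff`) — false as soon as an odd level is non-empty (landed
  period-two law), which is why `τ > 2` is strict.
* **§4 (K0) is vacuous from the cubic scale on.**  The landed cell theorems H6/H6a/H11d (`tower_of_levels`, `tower_of_unitLevels`,
  `tower_of_nonemptyWindow`) carry the hypothesis (K0) «levels `0 < k < n` are empty» (the Kronecker length bound `N ≤ k²`, BI17
  Thm 5.9(1), not in the tree).  But a level of degree `k·n² > m ≥ n·n²` has `k > n`, so (K0) is never invoked once `n³ ≤ m`: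
  `tower_cubic_of_levels` ((U), (Ko), (P) only), `tower_wall_of_unitLevels` ((U), (Ko) only, `2n·n² ≤ m`),
  `tower_of_nonemptyRun` (a non-empty run `a, …, 2a−1` of degree `≤ m` alone; format-general).
* **§5 Tree level.**  For `3 < τ < 4` the item follows from (U)+(Ko) eventually in `n` (`invariantSaturation_three_of_unitLevels'`,
  the landed H6b minus (K0)), or from Kronecker positivity on the window `[n, 2n)` READ AT FORMAT `n²` ITSELF
  (`invariantSaturation_three_of_window_self`, the landed H11d minus (K0), emptiness made format-intrinsic), or from the tower at
  the single wall cell `m = 2n·n²` per `n` (`invariantSaturation_three_of_wallCells`).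
All hypotheses inline; no proposition defined; no `sorry`; standard axioms.  Nothing here proves `ω = 2`; (U) (BI17 Problem 5.23,
Latin cubes), (Ko)/(NE) (Kronecker positivity `g((k^{n²})³) > 0`, BI17 Thm 5.9(3), Problem 5.19) remain the open inputs for
`3 < τ < 4`, and (P) (odd levels of degree `> m` pass) for `2 < τ ≤ 3`.
[cite: BurgisserIkenmeyer2017, §5 (5.2), Thm 5.3, Thm 5.9, Problems 5.19 and 5.23; BurgisserIkenmeyer2011, Lemma 3.2, §3.1]
-/

noncomputable section

open scoped BigOperators
open Finset Filter

namespace Summit.MatrixMultiplication.MatrixMultiplication.Theorems.ObstructionCalculus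

open Literature.Computability.AlgebraicComplexity (unitTensor actTensor)

section TowerCells

variable {m : ℕ}

/-! ### §1 · Monotonicity of the dichotomy and of the tower in the secant order `m` -/

/-- **The pass-or-empty dichotomy is monotone in `m`** (`N ≤ m ≤ m'`): a passing level keeps passing (H11a) and emptiness does
not depend on the format. [this node] -/
theorem dichotomy_mono {N m' k : ℕ} (hN : N ≤ m) (h : m ≤ m')
    (hk : k ∈ passLevels m N ∪ emptyLevels m N) : k ∈ passLevels m' N ∪ emptyLevels m' N := by
  rcases hk with hp | he
  · exact Or.inl (passLevels_mono hN h hp)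
  · refine Or.inr ?_
    rwa [emptyLevels_eq_of_le hN h]

/-- **TOWER MONOTONICITY: the tower at `(n, m)` gives the tower at every `(n, m')`, `m ≤ m'`** — fewer levels have degree `> m'`,
and each of them keeps its status. [this node] -/
theorem tower_mono {N m' : ℕ} (hN : N ≤ m) (h : m ≤ m')
    (H : ∀ k : ℕ, m < k * N → k ∈ passLevels m N ∪ emptyLevels m N) :
    ∀ k : ℕ, m' < k * N → k ∈ passLevels m' N ∪ emptyLevels m' N :=
  fun k hk => dichotomy_mono hN h (H k (lt_of_le_of_lt h hk))

/-- Below degree `m` there is nothing to prove: a level of degree `kN ≤ m` passes or is empty (R1).  Hence the tower at `(N, m)` is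
the FULL dichotomy `passLevels ∪ emptyLevels = ℕ` at that cell. [bookkeeping] -/
theorem tower_iff_dichotomy {N : ℕ} :
    (∀ k : ℕ, m < k * N → k ∈ passLevels m N ∪ emptyLevels m N) ↔
      ∀ k : ℕ, k ∈ passLevels m N ∪ emptyLevels m N := by
  refine ⟨fun H k => ?_, fun H k _ => H k⟩
  by_cases hk : m < k * N
  · exact H k hk
  · by_cases he : k ∈ emptyLevels m N
    · exact Or.inr he
    · exact Or.inl (mem_passLevels_of_degree_le (not_lt.1 hk) he)

/-! ### §2 · Non-empty levels form a monoid; the first cell -/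

/-- Non-empty levels add: the product of two non-zero weight vectors is a non-zero weight vector of the summed level.
[cite: BurgisserIkenmeyer2011, Lemma 3.2] -/
theorem add_not_mem_emptyLevels {N a b : ℕ} (ha : a ∉ emptyLevels m N) (hb : b ∉ emptyLevels m N) :
    a + b ∉ emptyLevels m N := by
  intro hab
  have hbot : hwvSpace (rectType m N (a + b)) ((a + b) * N) = ⊥ := hab
  apply ha
  show hwvSpace (rectType m N a) (a * N) = ⊥
  rw [Submodule.eq_bot_iff]
  intro f hf
  by_contra hf0
  apply hb
  show hwvSpace (rectType m N b) (b * N) = ⊥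
  rw [Submodule.eq_bot_iff]
  intro g hg
  by_contra hg0
  have hfg : f * g ∈ hwvSpace (rectType m N (a + b)) ((a + b) * N) := by
    have h := mul_mem_hwvSpace hf hg
    rwa [rectType_add, ← add_mul] at h
  rw [hbot, Submodule.mem_bot] at hfg
  exact mul_ne_zero hf0 hg0 hfg

/-- **The first cell `m = N`: a level passes iff it is a level of the point `⟨m⟩`.**  (`⊇`: `⟨m⟩` has rank `≤ m`; `⊆`: a weight
vector non-zero somewhere on `GL_m³·⟨m⟩` is non-zero AT `⟨m⟩`, level sets being `GL_m³`-invariant at the first cell.)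
[cite: BurgisserIkenmeyer2017, (5.2), Thm 5.3] -/
theorem passLevels_self_eq_pointLevels : passLevels m m = pointLevels m (unitTensor ℂ m) := by
  apply Set.Subset.antisymm
  · intro k hk
    by_contra hnot
    refine hk fun f hf A B C hA hB hC => ?_
    by_contra hne
    have hmem : k ∈ pointLevels m (actTensor A B C (unitTensor ℂ m)) := ⟨f, hf, hne⟩
    rw [pointLevels_self_actTensor hA hB hC] at hmem
    exact hnot hmem
  · rw [← padUnitLast_self]
    exact pointLevels_padUnitLast_subset_passLevels m

/-- **The tower at the first cell `(n, n²)` says: every non-empty level `k ≥ 2` is a level of the point `⟨n²⟩`** (stated at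
`m = N ≥ 1`).  By the landed period-two law (`pointLevels_padUnitLast_subset_even`) this fails as soon as some odd level is
non-empty — the structural reason why the scale `τ > 2` of the item is strict. [this node] -/
theorem tower_self_iff (hm : 1 ≤ m) :
    (∀ k : ℕ, m < k * m → k ∈ passLevels m m ∪ emptyLevels m m) ↔
      ∀ k : ℕ, 2 ≤ k → k ∉ emptyLevels m m → k ∈ pointLevels m (unitTensor ℂ m) := by
  rw [← passLevels_self_eq_pointLevels]
  refine ⟨fun H k hk hne => ?_, fun H k hk => ?_⟩
  · have hmk : m < k * m := by nlinarith
    exact (H k hmk).resolve_right hne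
  · have hk2 : 2 ≤ k := by
      by_contra h
      have : k * m ≤ 1 * m := Nat.mul_le_mul_right _ (by omega)
      omega
    by_cases hne : k ∈ emptyLevels m m
    · exact Or.inr hne
    · exact Or.inl (H k hk2 hne)

/-- At the first cell an odd non-empty level breaks the tower (`m = N ≥ 2`). [this node] -/
theorem not_tower_self_of_odd {k : ℕ} (hm : 2 ≤ m) (hk : Odd k) (hne : k ∉ emptyLevels m m) :
    ¬ ∀ j : ℕ, m < j * m → j ∈ passLevels m m ∪ emptyLevels m m := by
  intro H
  have hk2 : 2 ≤ k := by
    rcases hk with ⟨j, rfl⟩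
    rcases Nat.eq_zero_or_pos j with h | h
    · subst h
      exact absurd (one_mem_emptyLevels_self hm) (by simpa using hne)
    · omega
  have hmem := (tower_self_iff (le_trans one_le_two hm)).1 H k hk2 hne
  rw [← padUnitLast_self] at hmem
  exact (Nat.not_even_iff_odd.2 hk) (pointLevels_padUnitLast_subset_even hm le_rfl hmem)

/-! ### §4 · From the cubic scale on, hypothesis (K0) is vacuous -/

/-- A level of degree `k·n² > m ≥ n·n²` has `k > n`. [bookkeeping] -/
theorem lt_level_of_cubic {n k : ℕ} (hm : n * (n * n) ≤ m) (hk : m < k * (n * n)) : n < k := by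
  by_contra h
  exact absurd (lt_of_le_of_lt hm hk) (not_lt.2 (Nat.mul_le_mul_right _ (not_lt.1 h)))

/-- A level of degree `k·n² > m ≥ 2n·n²` has `k > 2n`. [bookkeeping] -/
theorem lt_level_of_wall {n k : ℕ} (hm : 2 * n * (n * n) ≤ m) (hk : m < k * (n * n)) : 2 * n < k := by
  by_contra h
  exact absurd (lt_of_le_of_lt hm hk) (not_lt.2 (Nat.mul_le_mul_right _ (not_lt.1 h)))

/-- **H6 from the cubic scale on, WITHOUT (K0).**  At a cell `n·n² ≤ m` the tower follows from (U) even levels `≥ n` are levels of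
`⟨n²⟩`, (Ko) some odd level `o ∈ {n, n+1}` is non-empty, (P) non-empty odd levels `k ∈ (n, 2n)` of degree `> m` pass.  Compared
with the landed `tower_of_levels` the hypothesis (K0) is gone: a level of degree `> m ≥ n³` has `k > n`. [this node] -/
theorem tower_cubic_of_levels (n : ℕ) (hm : n * (n * n) ≤ m)
    (hU : ∀ e : ℕ, Even e → n ≤ e → e ∈ pointLevels (n * n) (padUnitLast m (n * n)))
    (hKo : ∃ o : ℕ, Odd o ∧ n ≤ o ∧ o ≤ n + 1 ∧ o ∉ emptyLevels m (n * n))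
    (hP : ∀ k : ℕ, Odd k → n < k → k < 2 * n → m < k * (n * n) → k ∉ emptyLevels m (n * n) →
      k ∈ passLevels m (n * n)) :
    ∀ k : ℕ, m < k * (n * n) → k ∈ passLevels m (n * n) ∪ emptyLevels m (n * n) := by
  intro k hk
  rw [Set.mem_union, or_iff_not_imp_right]
  intro hne
  have hnk : n < k := lt_level_of_cubic hm hk
  have hn0 : 0 < n := by
    rcases Nat.eq_zero_or_pos n with h | h
    · subst h; simp at hk
    · exact h
  rcases Nat.even_or_odd k with he | ho
  · exact mem_passLevels_of_unitLevels hU he hnk.le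
  · by_cases hk2 : k < 2 * n
    · exact hP k ho hnk hk2 hk hne
    · have hk2' : 2 * n + 1 ≤ k := by
        have hne2 : k ≠ 2 * n := fun h => (Nat.not_even_iff_odd.2 ho) (h ▸ even_two_mul n)
        omega
      obtain ⟨o, ho', hno, hon, hWo⟩ := hKo
      have ho2n : o < 2 * n := by
        obtain ⟨j, hj⟩ := ho'
        omega
      have hoU : o ∈ passLevels m (n * n) := by
        by_cases hom : o * (n * n) ≤ m
        · exact mem_passLevels_of_degree_le hom hWo
        · have hno' : n < o := by
            rcases hno.eq_or_lt with h | h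
            · exact absurd (h ▸ hm) hom
            · exact h
          exact hP o ho' hno' ho2n (lt_of_not_ge hom) hWo
      have hok : o ≤ k := by omega
      have hko : Even (k - o) := Nat.Odd.sub_odd ho ho'
      have hkon : n ≤ k - o := by omega
      have h3 := add_mem_passLevels hoU (mem_passLevels_of_unitLevels hU hko hkon)
      rwa [Nat.add_sub_cancel' hok] at h3

/-- **H6a WITHOUT (K0): above the wall `2n·n² ≤ m` the tower is (U) + (Ko) alone** — no hypothesis about `σ_m`, none about the
low levels: a level of degree `> m` has `k > 2n`, so it is even (U) or `o + even` with `o·n² ≤ (n+1)·n² ≤ m` passing by R1.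
[this node] -/
theorem tower_wall_of_unitLevels (n : ℕ) (hm : 2 * n * (n * n) ≤ m)
    (hU : ∀ e : ℕ, Even e → n ≤ e → e ∈ pointLevels (n * n) (padUnitLast m (n * n)))
    (hKo : ∃ o : ℕ, Odd o ∧ n ≤ o ∧ o ≤ n + 1 ∧ o ∉ emptyLevels m (n * n)) :
    ∀ k : ℕ, m < k * (n * n) → k ∈ passLevels m (n * n) ∪ emptyLevels m (n * n) := by
  have hm' : n * (n * n) ≤ m := le_trans (Nat.mul_le_mul_right _ (by omega)) hm
  refine tower_cubic_of_levels n hm' hU hKo fun k _ _ hk2 hk _ => ?_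
  exfalso
  have := lt_level_of_wall hm hk
  omega

/-- **A non-empty run decides the tower (format-general, no (K0)).**  If the levels `a, a+1, …, 2a−1` (`a ≥ 1`) are non-empty and
fit below the degree bound, `(2a−1)·N ≤ m`, then EVERY level of degree `> m` passes: the run passes by R1 and generates every level
`≥ a` (conductor law H11b), while a level of degree `> m` is `≥ 2a`. [this node] -/
theorem tower_of_nonemptyRun {N a : ℕ} (ha : 0 < a) (hdeg : (2 * a - 1) * N ≤ m)
    (hNE : ∀ j : ℕ, j < a → a + j ∉ emptyLevels m N) :
    ∀ k : ℕ, m < k * N → k ∈ passLevels m N ∪ emptyLevels m N := by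
  intro k hk
  have hak : 2 * a ≤ k := by
    by_contra h
    have : k * N ≤ (2 * a - 1) * N := Nat.mul_le_mul_right _ (by omega)
    omega
  refine Or.inl (mem_passLevels_of_run ha (fun j hj => mem_passLevels_of_degree_le ?_ (hNE j hj)) k (by omega))
  exact le_trans (Nat.mul_le_mul_right _ (by omega)) hdeg

/-- **H11d WITHOUT (K0): above the wall, Kronecker positivity on the window `[n, 2n)` alone gives the tower** — and the window
may be read at the corner format `n²` itself (emptiness is format-intrinsic). [this node] -/
theorem tower_wall_of_window_self (n : ℕ) (hm : 2 * n * (n * n) ≤ m)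
    (hNE : ∀ k : ℕ, n ≤ k → k < 2 * n → k ∉ emptyLevels (n * n) (n * n)) :
    ∀ k : ℕ, m < k * (n * n) → k ∈ passLevels m (n * n) ∪ emptyLevels m (n * n) := by
  intro k hk
  have hn0 : 0 < n := by
    rcases Nat.eq_zero_or_pos n with h | h
    · subst h; simp at hk
    · exact h
  have hNm : n * n ≤ m := le_trans (le_trans (Nat.le_mul_of_pos_left _ (by omega)) (le_refl (2 * n * (n * n)))) hm
  refine tower_of_nonemptyRun (a := n) hn0 (le_trans (Nat.mul_le_mul_right _ (by omega)) hm) (fun j hj => ?_) k hk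
  rw [mem_emptyLevels_iff_self hNm]
  exact hNE (n + j) (by omega) (by omega)

end TowerCells

end Summit.MatrixMultiplication.MatrixMultiplication.Theorems.ObstructionCalculus

/-! ### §5 · Tree level: the item is one cell per `(τ, n)`; for `3 < τ < 4` it is (U)+(Ko), or window positivity, or the wall cells -/

namespace Summit.MatrixMultiplication.MatrixMultiplication.Theses.ObstructionDescent

open Summit.MatrixMultiplication.MatrixMultiplication.Theorems.ObstructionCalculus
open Literature.Computability.AlgebraicComplexity (unitTensor)

/-- **`InvariantSaturation` IS ONE CELL PER `(τ, n)` (equivalence; credits nothing by itself).**  The item holds iff for every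
scale `2 < τ < 4`, eventually in `n`, the tower holds at SOME cell `m₀ ≥ n²` lying below every admissible cell (`n² ≤ m`,
`n^τ ≤ m` ⟹ `m₀ ≤ m`) — by tower monotonicity (§1).  The canonical choice is the lowest admissible cell `m₀ = max (n², ⌈n^τ⌉)`.
[this node] -/
theorem invariantSaturation_iff_lowestCell : InvariantSaturation ↔
    ∀ τ : ℝ, 2 < τ → τ < 4 → ∃ n₁ : ℕ, ∀ n : ℕ, n₁ ≤ n → ∃ m₀ : ℕ, n * n ≤ m₀ ∧
      (∀ m : ℕ, n * n ≤ m → (n : ℝ) ^ τ ≤ (m : ℝ) → m₀ ≤ m) ∧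
      ∀ k : ℕ, m₀ < k * (n * n) → k ∈ passLevels m₀ (n * n) ∪ emptyLevels m₀ (n * n) := by
  rw [invariantSaturation_iff_levels]
  refine ⟨fun H τ hτ hτ4 => ?_, fun H τ hτ hτ4 => ?_⟩
  · obtain ⟨n₀, hn₀⟩ := H τ hτ hτ4
    refine ⟨n₀, fun n hn => ⟨max (n * n) ⌈(n : ℝ) ^ τ⌉₊, le_max_left _ _, fun m hnm hτm => ?_, ?_⟩⟩
    · exact max_le hnm (Nat.ceil_le.2 hτm)
    · refine hn₀ n _ hn (le_max_left _ _) ?_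
      calc (n : ℝ) ^ τ ≤ (⌈(n : ℝ) ^ τ⌉₊ : ℝ) := Nat.le_ceil _
        _ ≤ ((max (n * n) ⌈(n : ℝ) ^ τ⌉₊ : ℕ) : ℝ) := by exact_mod_cast le_max_right _ _
  · obtain ⟨n₁, hn₁⟩ := H τ hτ hτ4
    refine ⟨n₁, fun n m hn hnm hτm => ?_⟩
    obtain ⟨m₀, hm₀, hlow, hT⟩ := hn₁ n hn
    exact tower_mono hm₀ (hlow m hnm hτm) hT

/-- **One cell per `n` suffices outright (CONDITIONAL reduction; credits nothing by itself).**  If, eventually in `n`, the tower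
holds at some cell `m₀(n) ≥ n²` lying below every admissible cell of EVERY scale `τ > 2` (e.g. `m₀(n) = n² + c`, or any
`m₀(n) ≤ n²·(1 + o(1))`), then `InvariantSaturation` holds — by tower monotonicity.  (Compare the aside `BlockLinearSaturation`,
which asserts the tower at `m₀ = c·n²`.) [this node] -/
theorem invariantSaturation_of_cells
    (h : ∃ n₁ : ℕ, ∀ n : ℕ, n₁ ≤ n → ∃ m₀ : ℕ, n * n ≤ m₀ ∧
      (∀ τ : ℝ, 2 < τ → ∀ m : ℕ, n * n ≤ m → (n : ℝ) ^ τ ≤ (m : ℝ) → m₀ ≤ m) ∧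
      ∀ k : ℕ, m₀ < k * (n * n) → k ∈ passLevels m₀ (n * n) ∪ emptyLevels m₀ (n * n)) :
    InvariantSaturation := by
  obtain ⟨n₁, hn₁⟩ := h
  refine invariantSaturation_iff_lowestCell.2 fun τ hτ _ => ⟨n₁, fun n hn => ?_⟩
  obtain ⟨m₀, hm₀, hlow, hT⟩ := hn₁ n hn
  exact ⟨m₀, hm₀, hlow τ hτ, hT⟩

/-- **For `3 < τ < 4` the item is ONE WALL CELL PER `n`:** the tower at the cells `(n, 2n·n²)`, eventually in `n`, gives the level
reading of the item at every scale `3 < τ < 4`. [this node] -/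
theorem invariantSaturation_three_of_wallCells
    (h : ∃ n₁ : ℕ, ∀ n : ℕ, n₁ ≤ n → ∀ k : ℕ, 2 * n * (n * n) < k * (n * n) →
      k ∈ passLevels (2 * n * (n * n)) (n * n) ∪ emptyLevels (2 * n * (n * n)) (n * n)) :
    ∀ τ : ℝ, 3 < τ → τ < 4 → ∃ n₀ : ℕ, ∀ n m : ℕ, n₀ ≤ n → n * n ≤ m → (n : ℝ) ^ τ ≤ (m : ℝ) →
      ∀ k : ℕ, m < k * (n * n) → k ∈ passLevels m (n * n) ∪ emptyLevels m (n * n) := by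
  obtain ⟨n₁, h⟩ := h
  intro τ hτ3 _
  obtain ⟨n₂, hn₂⟩ := eventually_primitive_bound_le_rpow hτ3
  refine ⟨max n₁ n₂, fun n m hn hnm hτm k hk => ?_⟩
  have hbound : 2 * n * (n * n) ≤ m := by
    have h1 := hn₂ n (le_trans (le_max_right _ _) hn)
    exact_mod_cast h1.trans hτm
  have hn0 : 0 < n := by
    rcases Nat.eq_zero_or_pos n with h0 | h0
    · subst h0; simp at hk
    · exact h0
  have hN : n * n ≤ 2 * n * (n * n) := Nat.le_mul_of_pos_left _ (by omega)
  exact tower_mono hN hbound (h n (le_trans (le_max_left _ _) hn)) k hk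

/-- **H6b WITHOUT (K0): for `3 < τ < 4` the invariant tower is unit-tensor combinatorics (U) plus one Kronecker positivity (Ko).**
If (U) and (Ko) hold eventually in `n` at every cell `m ≥ n²`, the level reading of the item holds at every scale `3 < τ < 4`.
(The landed `invariantSaturation_three_of_unitLevels` asks in addition for (K0).) [this node] -/
theorem invariantSaturation_three_of_unitLevels'
    (h : ∃ n₁ : ℕ, ∀ n m : ℕ, n₁ ≤ n → n * n ≤ m →
      (∀ e : ℕ, Even e → n ≤ e → e ∈ pointLevels (n * n) (padUnitLast m (n * n))) ∧
      (∃ o : ℕ, Odd o ∧ n ≤ o ∧ o ≤ n + 1 ∧ o ∉ emptyLevels m (n * n))) :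
    ∀ τ : ℝ, 3 < τ → τ < 4 → ∃ n₀ : ℕ, ∀ n m : ℕ, n₀ ≤ n → n * n ≤ m → (n : ℝ) ^ τ ≤ (m : ℝ) →
      ∀ k : ℕ, m < k * (n * n) → k ∈ passLevels m (n * n) ∪ emptyLevels m (n * n) := by
  obtain ⟨n₁, h⟩ := h
  intro τ hτ3 _
  obtain ⟨n₂, hn₂⟩ := eventually_primitive_bound_le_rpow hτ3
  refine ⟨max n₁ n₂, fun n m hn hnm hτm => ?_⟩
  obtain ⟨hU, hKo⟩ := h n m (le_trans (le_max_left _ _) hn) hnm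
  have hbound : 2 * n * (n * n) ≤ m := by
    have h1 := hn₂ n (le_trans (le_max_right _ _) hn)
    exact_mod_cast h1.trans hτm
  exact tower_wall_of_unitLevels n hbound hU hKo

/-- **H11d WITHOUT (K0), window read at format `n²`: for `3 < τ < 4` the invariant tower is Kronecker positivity on `[n, 2n)`.**
If, eventually in `n`, the levels `n ≤ k < 2n` are non-empty AT THE CORNER FORMAT `n²` (`g((k^{n²}),(k^{n²}),(k^{n²})) > 0`,
BI17 Thm 5.9(3) / Problem 5.19), the level reading of the item holds at every scale `3 < τ < 4` — nothing about `σ_m`, nothing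
about `⟨n²⟩`, nothing about the low levels. [cite: BurgisserIkenmeyer2017, Thm 5.9, Problem 5.19] -/
theorem invariantSaturation_three_of_window_self
    (h : ∃ n₁ : ℕ, ∀ n : ℕ, n₁ ≤ n → ∀ k : ℕ, n ≤ k → k < 2 * n → k ∉ emptyLevels (n * n) (n * n)) :
    ∀ τ : ℝ, 3 < τ → τ < 4 → ∃ n₀ : ℕ, ∀ n m : ℕ, n₀ ≤ n → n * n ≤ m → (n : ℝ) ^ τ ≤ (m : ℝ) →
      ∀ k : ℕ, m < k * (n * n) → k ∈ passLevels m (n * n) ∪ emptyLevels m (n * n) := by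
  obtain ⟨n₁, h⟩ := h
  intro τ hτ3 _
  obtain ⟨n₂, hn₂⟩ := eventually_primitive_bound_le_rpow hτ3
  refine ⟨max n₁ n₂, fun n m hn _ hτm => ?_⟩
  have hbound : 2 * n * (n * n) ≤ m := by
    have h1 := hn₂ n (le_trans (le_max_right _ _) hn)
    exact_mod_cast h1.trans hτm
  exact tower_wall_of_window_self n hbound (h n (le_trans (le_max_left _ _) hn))

/-- **The cubic scale `τ = 3` included, WITHOUT (K0):** if (U), (Ko) and (P) «non-empty odd levels `k ∈ (n, 2n)` of degree `> m`
pass» hold eventually in `n` at every cell `m ≥ n³`, then the level reading holds at every scale `3 ≤ τ < 4`. [this node] -/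
theorem invariantSaturation_cubic_of_levels
    (h : ∃ n₁ : ℕ, ∀ n m : ℕ, n₁ ≤ n → n * (n * n) ≤ m →
      (∀ e : ℕ, Even e → n ≤ e → e ∈ pointLevels (n * n) (padUnitLast m (n * n))) ∧
      (∃ o : ℕ, Odd o ∧ n ≤ o ∧ o ≤ n + 1 ∧ o ∉ emptyLevels m (n * n)) ∧
      (∀ k : ℕ, Odd k → n < k → k < 2 * n → m < k * (n * n) → k ∉ emptyLevels m (n * n) →
        k ∈ passLevels m (n * n))) :
    ∀ τ : ℝ, 3 ≤ τ → τ < 4 → ∃ n₀ : ℕ, ∀ n m : ℕ, n₀ ≤ n → n * n ≤ m → (n : ℝ) ^ τ ≤ (m : ℝ) →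
      ∀ k : ℕ, m < k * (n * n) → k ∈ passLevels m (n * n) ∪ emptyLevels m (n * n) := by
  obtain ⟨n₁, h⟩ := h
  intro τ hτ3 _
  refine ⟨max n₁ 1, fun n m hn _ hτm => ?_⟩
  have hn1 : 1 ≤ n := le_trans (le_max_right _ _) hn
  have hcub : n * (n * n) ≤ m := by
    have hn1' : (1 : ℝ) ≤ n := by exact_mod_cast hn1
    have h3 : ((n * (n * n) : ℕ) : ℝ) = (n : ℝ) ^ (3 : ℝ) := by
      rw [show (3 : ℝ) = ((3 : ℕ) : ℝ) by norm_num, Real.rpow_natCast]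
      push_cast
      ring
    have hle : (n : ℝ) ^ (3 : ℝ) ≤ (n : ℝ) ^ τ := Real.rpow_le_rpow_of_exponent_le hn1' hτ3
    exact_mod_cast (h3.le.trans hle).trans hτm
  obtain ⟨hU, hKo, hP⟩ := h n m (le_trans (le_max_left _ _) hn) hcub
  exact tower_cubic_of_levels n hcub hU hKo hP

end Summit.MatrixMultiplication.MatrixMultiplication.Theses.ObstructionDescent

end
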